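import Summits.Ventures.PercRepro.ProfilePointedCircuitClassesMixedPairDual
import Summits.Ventures.PercRepro.ProfileTwoTop

/-!
# PercRepro — `(G)` HOLDS: THE «BOTTOM ≤ TOP − 2» COMPARISON OF A NULLITY-`3` MATROID MARKED BY A PAIR, AND THE
SINGLE-TRIANGLE CASE OF `InOutBottomFour` UNCONDITIONALLY (p5, gen 39; `proofs/P5-GM1.md` §55)

`MixedPairBottomTopTwo` (InOutTriangleIV) was a CONJECTURE def.  This module discharges it
(`mixedPairBottomTopTwo_holds`) by duality from the rank-`3` double counting `mixedPair_dual_core`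
(MixedPairDual): for `X ⊆ E`, `X ∈ ℐ(M)` iff `E − X` spans `M✶` (`rk_eq_card_iff_rk_dual_sdiff`, from p10's
`dual_spanning_iff_indep_compl`), so on `H₀ = E − f − g` with `T = {f, g} ∈ ℐ(M)` the four conditions of `(G)`
read `E − Y = (H₀ − Y) ∪ T` spans `M✶`, `Y` spans `M✶`, `H₀ − Y` spans `M✶`, `Y ∪ T` spans `M✶`; `M✶` has rank
`3 = #E − ρ(M)`, is loopless because `M` has no coloops, and `H₀` spans `M✶` because `T ∈ ℐ(M)`.

With it the single-triangle theorem of InOutTriangleIV loses its hypothesis: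
**`inCount_four_le_outCount_five_of_triangle'`** — on `#E = ρ + 4`, `ρ ≥ 7`, `E − e` without loops or coloops,
`in_4(e) ≤ out_5(e)` at every point `e` whose only circuit with `≤ ρ − 1` elements is a triangle `{e, f, g}`.
-/

open scoped Matroid

namespace PercRepro.Cogirth

open Finset ThmH Skew Shadow Profile

variable {α : Type} [DecidableEq α] {M : Matroid α} [M.Finite]

section Duality

/-- `X ⊆ E` is independent in `M` iff `E − X` spans `M✶`, in the finset vocabulary. -/
theorem rk_eq_card_iff_rk_dual_sdiff {X : Finset α} (hX : X ⊆ gr M) :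
    rk M X = X.card ↔ rk M✶ (gr M \ X) = rk M✶ (gr M) := by
  have h1 := dual_spanning_iff_indep_compl (M := M) (X := gr M \ X) sdiff_subset
  rw [Finset.sdiff_sdiff_eq_self hX] at h1
  have h2 := spanning_iff_rk_eq (M := M✶) (X := gr M \ X) (by rw [gr_dual]; exact sdiff_subset)
  rw [gr_dual] at h2
  rw [← h2, h1]
  exact ⟨indep_of_rk_eq_card, rk_eq_card_of_indep⟩

omit [DecidableEq α] in
/-- The rank of the dual of a nullity-`3` matroid is `3`. -/
theorem rk_dual_gr_of_nullity_three (hn : (gr M).card = rk M (gr M) + 3) : rk M✶ (gr M) = 3 := by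
  have := rk_dual_add_rk (M := M)
  omega

/-- The dual of a coloop-free matroid is loopless. -/
theorem rk_dual_singleton_of_coloopFree (hcf : ∀ x ∈ gr M, rk M ((gr M).erase x) = rk M (gr M)) {x : α}
    (hx : x ∈ gr M) : rk M✶ {x} = 1 := by
  have h1 := dual_indep_iff_spanning_compl (M := M) (X := {x}) (singleton_subset_iff.2 hx)
  rw [spanning_iff_rk_eq sdiff_subset, sdiff_singleton_eq_erase] at h1
  have h2 := rk_eq_card_of_indep (h1.2 (hcf x hx))
  rw [card_singleton] at h2
  exact h2

end Duality

section Holds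

variable {f g : α}

/-- `E − {f, g} = (E − f) − g`. -/
theorem gr_sdiff_pair : gr M \ {f, g} = ((gr M).erase f).erase g := by
  ext x
  simp only [mem_sdiff, mem_insert, mem_singleton, mem_erase]
  tauto

/-- For `Y ⊆ H₀ = (E − f) − g`: `E − Y = (H₀ − Y) ∪ {f, g}`. -/
theorem gr_sdiff_eq_of_subset (hf : f ∈ gr M) (hg : g ∈ gr M) {Y : Finset α}
    (hY : Y ⊆ ((gr M).erase f).erase g) : gr M \ Y = ((gr M).erase f).erase g \ Y ∪ {f, g} := by
  ext x
  simp only [mem_sdiff, mem_union, mem_erase, mem_insert, mem_singleton]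
  constructor
  · rintro ⟨hx, hxY⟩
    by_cases hxf : x = f
    · exact Or.inr (Or.inl hxf)
    by_cases hxg : x = g
    · exact Or.inr (Or.inr hxg)
    exact Or.inl ⟨⟨hxg, hxf, hx⟩, hxY⟩
  · rintro (⟨⟨_, _, hx⟩, hxY⟩ | hx | hx)
    · exact ⟨hx, hxY⟩
    · subst hx
      exact ⟨hf, fun h => (mem_erase.1 (hY h)).2 |> fun h' => (mem_erase.1 h').1 rfl⟩
    · subst hx
      exact ⟨hg, fun h => (mem_erase.1 (hY h)).1 rfl⟩

/-- For `Y ⊆ H₀ = (E − f) − g`: `E − ((H₀ − Y) ∪ {f, g}) = Y`. -/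
theorem gr_sdiff_sdiff_union_pair (hf : f ∈ gr M) (hg : g ∈ gr M) {Y : Finset α}
    (hY : Y ⊆ ((gr M).erase f).erase g) : gr M \ (((gr M).erase f).erase g \ Y ∪ {f, g}) = Y := by
  rw [← gr_sdiff_eq_of_subset hf hg hY,
    Finset.sdiff_sdiff_eq_self (hY.trans ((erase_subset _ _).trans (erase_subset _ _)))]

/-- `E − (Y ∪ {f, g}) = ((E − f) − g) − Y`. -/
theorem gr_sdiff_union_pair (Y : Finset α) :
    gr M \ (Y ∪ {f, g}) = ((gr M).erase f).erase g \ Y := by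
  ext x
  simp only [mem_sdiff, mem_union, mem_erase, mem_insert, mem_singleton]
  tauto

/-- For `Y ⊆ H₀ = (E − f) − g`: `E − (H₀ − Y) = Y ∪ {f, g}`. -/
theorem gr_sdiff_sdiff_eq_union_pair (hf : f ∈ gr M) (hg : g ∈ gr M) {Y : Finset α}
    (hY : Y ⊆ ((gr M).erase f).erase g) : gr M \ (((gr M).erase f).erase g \ Y) = Y ∪ {f, g} := by
  rw [← gr_sdiff_union_pair, Finset.sdiff_sdiff_eq_self]
  exact union_subset (hY.trans ((erase_subset _ _).trans (erase_subset _ _)))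
    (insert_subset hf (singleton_subset_iff.2 hg))

/-- **`(G)` HOLDS** — `MixedPairBottomTopTwo α`: on every nullity-`3` matroid `M` (`#E = ρ + 3`, `ρ ≥ 6`) without
loops or coloops and every independent pair `{f, g}`, with `H₀ = E − f − g`, the `3`-subsets `Y ⊆ H₀` with `Y ∈ ℐ`
and `(H₀ − Y) ∪ {f, g} ∈ ℐ` are at most those with `Y ∪ {f, g} ∈ ℐ` and `H₀ − Y ∈ ℐ`.  By duality from
`mixedPair_dual_core` on `M✶` (the hypothesis «loopless» is not needed). -/
theorem mixedPairBottomTopTwo_holds : MixedPairBottomTopTwo α := by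
  intro M _ f g hf hg hfg hn hR _hll hcf hfg2
  have hgrR : gr M✶ = gr M := gr_dual
  have hR3 : rk M✶ (gr M✶) = 3 := by rw [hgrR]; exact rk_dual_gr_of_nullity_three hn
  have hllR : ∀ x ∈ gr M✶, rk M✶ {x} = 1 := by
    intro x hx
    rw [hgrR] at hx
    exact rk_dual_singleton_of_coloopFree hcf hx
  have hT : ({f, g} : Finset α) ⊆ gr M := insert_subset hf (singleton_subset_iff.2 hg)
  have hH₀E : ((gr M).erase f).erase g ⊆ gr M := (erase_subset _ _).trans (erase_subset _ _)
  have hHR : rk M✶ (((gr M✶).erase f).erase g) = 3 := by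
    rw [hgrR]
    have h := (rk_eq_card_iff_rk_dual_sdiff (M := M) (X := {f, g}) hT).1 (by rw [hfg2, card_pair hfg])
    rw [gr_sdiff_pair] at h
    rw [h, ← hgrR, hR3]
  have h9 : 9 ≤ (gr M✶).card := by rw [hgrR, hn]; omega
  have core := mixedPair_dual_core hR3 hllR (by rw [hgrR]; exact hf) (by rw [hgrR]; exact hg) hfg hHR h9
  rw [hgrR] at core
  -- transport the two filters through duality
  have hLeq := filter_congr (s := (((gr M).erase f).erase g).powersetCard 3)
      (p := fun Y => rk M Y = 3 ∧
        rk M (((gr M).erase f).erase g \ Y ∪ {f, g}) = (((gr M).erase f).erase g \ Y ∪ {f, g}).card)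
      (q := fun Y => rk M✶ Y = 3 ∧ rk M✶ (((gr M).erase f).erase g \ Y ∪ {f, g}) = 3)
      (fun Y hY => by
        rw [mem_powersetCard] at hY
        have e1 := rk_eq_card_iff_rk_dual_sdiff (M := M) (X := Y) (hY.1.trans hH₀E)
        rw [gr_sdiff_eq_of_subset hf hg hY.1, ← hgrR, hR3, hgrR] at e1
        have e2 := rk_eq_card_iff_rk_dual_sdiff (M := M) (X := ((gr M).erase f).erase g \ Y ∪ {f, g})
          (union_subset (sdiff_subset.trans hH₀E) hT)
        rw [gr_sdiff_sdiff_union_pair hf hg hY.1, ← hgrR, hR3, hgrR] at e2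
        rw [hY.2] at e1
        rw [← e2, ← e1]
        exact and_comm)
  have hUeq := filter_congr (s := (((gr M).erase f).erase g).powersetCard 3)
      (p := fun Y => rk M (Y ∪ {f, g}) = 5 ∧
        rk M (((gr M).erase f).erase g \ Y) = (((gr M).erase f).erase g \ Y).card)
      (q := fun Y => rk M✶ (Y ∪ {f, g}) = 3 ∧ rk M✶ (((gr M).erase f).erase g \ Y) = 3)
      (fun Y hY => by
        rw [mem_powersetCard] at hY
        have hYT : (Y ∪ {f, g}).card = 5 := by
          rw [card_union_of_disjoint, hY.2, card_pair hfg]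
          rw [disjoint_left]
          intro x hx hx'
          have := hY.1 hx
          rw [mem_erase, mem_erase] at this
          rw [mem_insert, mem_singleton] at hx'
          rcases hx' with rfl | rfl
          · exact this.2.1 rfl
          · exact this.1 rfl
        have e1 := rk_eq_card_iff_rk_dual_sdiff (M := M) (X := Y ∪ {f, g}) (union_subset (hY.1.trans hH₀E) hT)
        rw [gr_sdiff_union_pair, ← hgrR, hR3, hgrR, hYT] at e1
        have e2 := rk_eq_card_iff_rk_dual_sdiff (M := M) (X := ((gr M).erase f).erase g \ Y)
          (sdiff_subset.trans hH₀E)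
        rw [gr_sdiff_sdiff_eq_union_pair hf hg hY.1, ← hgrR, hR3, hgrR] at e2
        rw [← e2, ← e1]
        exact and_comm)
  rw [hLeq, hUeq]
  exact core

end Holds

section Corollary

variable {N : Matroid α} [N.Finite]

/-- **THE SINGLE-TRIANGLE CASE OF `InOutBottomFour`, UNCONDITIONALLY**: on `#E = ρ(E) + 4`, `ρ(E) ≥ 7`, with
`E − e` free of loops and coloops, at a point `e` with a triangle `{e, f, g}` (`ρ{f, g} = 2`, `e ∈ cl{f, g}`) such
that every independent `(ρ − 2)`-subset of `E − e` capturing `e` contains `f` and `g`, `in_4(e) ≤ out_5(e)`. -/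
theorem inCount_four_le_outCount_five_of_triangle'
    (hn : (gr N).card = rk N (gr N) + 4) (hR : 7 ≤ rk N (gr N)) {e f g : α}
    (he : e ∈ gr N) (hf : f ∈ gr N) (hg : g ∈ gr N) (hef : e ≠ f) (heg : e ≠ g) (hfg : f ≠ g)
    (hnc : rk N ((gr N).erase e) = rk N (gr N))
    (hll : ∀ x ∈ (gr N).erase e, rk N {x} = 1)
    (hcf : ∀ x ∈ (gr N).erase e, rk N (((gr N).erase e).erase x) = rk N (gr N))
    (hfg2 : rk N {f, g} = 2) (htri : e ∈ clF N {f, g})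
    (honly : ∀ X ⊆ (gr N).erase e, X.card + 2 = rk N (gr N) → rk N X = X.card → e ∈ clF N X → f ∈ X ∧ g ∈ X) :
    inCount N 4 e ≤ outCount N 5 e :=
  inCount_four_le_outCount_five_of_triangle mixedPairBottomTopTwo_holds hn hR he hf hg hef heg hfg hnc hll hcf
    hfg2 htri honly

end Corollary

end PercRepro.Cogirth
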